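import Summits.CriticalPhenomena.PercolationContinuityZ3.Theorems.PercNearOneGluingNoHeavyRsw3WMSFOneEnd
import Summits.CriticalPhenomena.PercolationContinuityZ3.Theorems.PercNearOneGluingNoHeavyRsw3WMSFeqFMSF
import HarnessLib

/-!
# RSW3 lane (P2, gen 30): THE MINIMAL SPANNING FOREST OF `ℤ^d` — **every component of the (free = wired) minimal spanning forest of `ℤ^d` has exactly one end**,
# almost surely, for every `d ≥ 2` (Lyons–Peres 2016 Thm. 11.12 + Prop. 11.7; the hypothesis `θ(p_c) = 0` is p205010)

builds on p205010 (kernel theorem, internal audit signed; external expert review pending).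

Cell `prim-rsw3`, prover seat `prim-rsw3-p2` (gen 30), memo `run/shared/lean/prim/rsw3/P2-RSWLITE.md` §37.  Support file
(`--supports stmt-CriticalPhenomena-4575`); no definitions, no named facts, no sorries.  Assembly of the gen-30 WMSF series: file VI (`ae_wmsf_oneEnded`: one end per component of
`𝔉_w(ℤ^d)`) and file VII (`ae_wmsf_eq_fmsf`: `𝔉_w = 𝔉_f` a.s. on `ℤ^d`).

* **`ae_fmsf_oneEnded`** — a.s. from every vertex of `ℤ^d` there is exactly one self-avoiding ray in the FREE minimal spanning forest `𝔉_f(U) = fmsf E(ℤ^d) U`;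
  `ae_fmsf_no_biInfinite_path`; **`ae_msf_Z3`** — `ℤ³` summary: `𝔉_w = 𝔉_f`, exactly one ray from every vertex, no bi-infinite path.

References: R. Lyons, Y. Peres, *Probability on Trees and Networks* (2016), Thm. 11.12, Prop. 11.7 [LyonsPeres2016]; R. Lyons, Y. Peres, O. Schramm, Ann. Probab. 34 (2006)
Thm. 1.1, Prop. 3.6 [LyonsPeresSchramm2006].
-/

noncomputable section

namespace Summit.CriticalPhenomena.PercolationContinuityZ3.Theorems.Rsw3

open MeasureTheory Literature.Probability.LatticeModels Literature.Probability.Percolation Literature.Probability.Percolation.Invasion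
open Literature.Barriers.CriticalPhenomena

variable {d : ℕ}

/-- **EVERY COMPONENT OF THE FREE MINIMAL SPANNING FOREST OF `ℤ^d` HAS EXACTLY ONE END** (`d ≥ 2`): almost surely, from every vertex there is exactly one self-avoiding ray in
`𝔉_f(U)` (`= 𝔉_w(U)` a.s., file VII; one end, file VI). [cite: LyonsPeres2016, Thm. 11.12 and Prop. 11.7] [cite: LyonsPeresSchramm2006, Thm. 1.1 and Prop. 3.6] -/
theorem ae_fmsf_oneEnded (hd : 2 ≤ d) :
    ∀ᵐ U ∂(labelMeasure (Site d)), ∀ v : Site d,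
      ∃! ρ : ℕ → Site d, Function.Injective ρ ∧ ρ 0 = v ∧ ∀ i, (SimpleGraph.fromEdgeSet (fmsf (zdGraph d).edgeSet U)).Adj (ρ i) (ρ (i + 1)) := by
  filter_upwards [ae_wmsf_oneEnded hd, ae_wmsf_eq_fmsf hd] with U h1 h2
  rw [← h2]
  exact h1

/-- Almost surely the free minimal spanning forest of `ℤ^d` (`d ≥ 2`) contains no self-avoiding bi-infinite path. [cite: LyonsPeres2016, Thm. 11.12 and Prop. 11.7] -/
theorem ae_fmsf_no_biInfinite_path (hd : 2 ≤ d) :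
    ∀ᵐ U ∂(labelMeasure (Site d)), ∀ β : ℤ → Site d, Function.Injective β →
      ¬ ∀ i : ℤ, (SimpleGraph.fromEdgeSet (fmsf (zdGraph d).edgeSet U)).Adj (β i) (β (i + 1)) := by
  filter_upwards [ae_wmsf_no_biInfinite_path hd, ae_wmsf_eq_fmsf hd] with U h1 h2
  rw [← h2]
  exact h1

/-- **ONE END, LITERALLY**: almost surely, any two self-avoiding rays of `𝔉_w(ℤ^d)` lying in the same component share a tail (`d ≥ 2`): both are backbones (file VI) and backbones of
one component share a tail (the canonical end, gen 29 file XXXIX). [cite: LyonsPeres2016, Thm. 11.12] [cite: LyonsPeresSchramm2006, Thm. 1.1] -/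
theorem ae_wmsf_rays_tail_equivalent (hd : 2 ≤ d) :
    ∀ᵐ U ∂(labelMeasure (Site d)), ∀ x y : Site d, (SimpleGraph.fromEdgeSet (wmsf (zdGraph d) U)).Reachable x y →
      ∀ ρ ρ' : ℕ → Site d, Function.Injective ρ → ρ 0 = x → (∀ i, (SimpleGraph.fromEdgeSet (wmsf (zdGraph d) U)).Adj (ρ i) (ρ (i + 1))) →
        Function.Injective ρ' → ρ' 0 = y → (∀ i, (SimpleGraph.fromEdgeSet (wmsf (zdGraph d) U)).Adj (ρ' i) (ρ' (i + 1))) →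
          ∃ a b, ∀ k, ρ (a + k) = ρ' (b + k) := by
  haveI : Nonempty (Fin d) := ⟨⟨0, by omega⟩⟩
  haveI : Infinite (Site d) := Pi.infinite_of_right
  filter_upwards [ae_wmsf_oneEnded hd, Literature.Barriers.CriticalPhenomena.ae_injective_labelMeasure (V := Site d), ae_forall_root_existsUnique_ray hd]
    with U hone hUinj hall
  have hex : ∀ v : Site d, ∃ R : ℕ → Site d, Function.Injective R ∧ R 0 = v ∧ ∀ i, (tree (zdGraph d) U v).Adj (R i) (R (i + 1)) :=
    fun v => (hall v).2.exists
  choose R hR hR0 hRadj using hex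
  have hRspec : ∀ v, Function.Injective (R v) ∧ R v 0 = v ∧ ∀ i, (tree (zdGraph d) U v).Adj (R v i) (R v (i + 1)) :=
    fun v => ⟨hR v, hR0 v, hRadj v⟩
  obtain ⟨-, h0, hinj, hadjF, -, -, htailR⟩ :=
    rayField_props zdGraph_preconnected_holds hUinj (fun v => (hall v).1) (fun v => (hall v).2) hRspec
  intro x y hxy ρ ρ' hρ hρ0 hρadj hρ' hρ'0 hρ'adj
  have e1 : ρ = R x := (hone x).unique ⟨hρ, hρ0, hρadj⟩ ⟨hinj x, h0 x, hadjF x⟩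
  have e2 : ρ' = R y := (hone y).unique ⟨hρ', hρ'0, hρ'adj⟩ ⟨hinj y, h0 y, hadjF y⟩
  subst e1 e2
  exact htailR x y hxy

/-- **`ℤ³`: THE MINIMAL SPANNING FOREST OF `ℤ³`** — almost surely the wired and free minimal spanning forests coincide, from every vertex there is exactly one self-avoiding ray in it,
and it contains no bi-infinite self-avoiding path. [cite: LyonsPeres2016, Thm. 11.12 and Prop. 11.7] [cite: LyonsPeresSchramm2006, Thm. 1.1] -/
theorem ae_msf_Z3 :
    ∀ᵐ U ∂(labelMeasure (Site 3)),
      wmsf (zdGraph 3) U = fmsf (zdGraph 3).edgeSet U ∧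
      (∀ v : Site 3, ∃! ρ : ℕ → Site 3, Function.Injective ρ ∧ ρ 0 = v ∧ ∀ i, (SimpleGraph.fromEdgeSet (wmsf (zdGraph 3) U)).Adj (ρ i) (ρ (i + 1))) ∧
      ∀ β : ℤ → Site 3, Function.Injective β → ¬ ∀ i : ℤ, (SimpleGraph.fromEdgeSet (wmsf (zdGraph 3) U)).Adj (β i) (β (i + 1)) := by
  filter_upwards [ae_wmsf_eq_fmsf (d := 3) (by norm_num), ae_wmsf_oneEnded (d := 3) (by norm_num), ae_wmsf_no_biInfinite_path (d := 3) (by norm_num)]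
    with U h1 h2 h3
  exact ⟨h1, h2, h3⟩

end Summit.CriticalPhenomena.PercolationContinuityZ3.Theorems.Rsw3
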